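import Summits.AtomisticToContinuum.BoseEinsteinCondensation.Theorems.BECCutLineWeakDisorderTwoReplicaTransienceBoundMeanFreeWindow
import Summits.AtomisticToContinuum.BoseEinsteinCondensation.Theorems.BECCutLineWeakDisorderTwoReplicaTransienceBoundSliceMomentCubic
import HarnessLib

/-!
# Crux `TwoReplicaTransienceBound` (stmt-AtomisticToContinuum-9687), line `SketchIdeator1` v7:
# the KINETIC window in Smoluchowski–Spitzer scaling (toolbox stub `stub_kineticWindow`)

Support file (`--supports stmt-AtomisticToContinuum-9687`, lead c4). The scale-covariant form of the mean-free window
(…MeanFreeWindow.lean): **for every finite-range repulsive pair potential of range `R > 0` (hard cores allowed), at every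
density with packing parameter `ρR³ ≤ 10⁻⁹`, eventually in the particle number, the two-replica overlap of the Feynman–Kac
heat-flow witnesses is `≤ 20` for all polymer lengths `T` with `ρ R T ≤ 10⁻⁹`** — i.e. up to an absolute number of mean-free
times `1/(ρR)` (the Smoluchowski encounter rate of two Brownian lines at mutual reach `R` is `∝ R` per unit time and unit
density; the expected Wiener-sausage volume is `∝ R t + R³`, Spitzer). Proof: `MeanFreeWindow.sliced_insertion_of_sliceBound`
with slices of length `R²` and the scale-covariant per-slice moment `stub_sliceMomentCubic` (`≤ 32R³ + 228096R³`), `M ≤ 2T/R² + 1`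
slices, so the insertion error is `∝ ρ (2RT + R³) ≤ 3·10⁻⁹ · 228128 · 256 ≤ (4/5)² ≤ q₀²`; then c3's recursion, survival floor
and slice reduction verbatim. The constants `10⁻⁹` are not optimised (the recursion tolerates `256 ρ M K ≤ q₀²`).
-/

noncomputable section

namespace Summit.AtomisticToContinuum.BoseEinsteinCondensation.Cruxes.TwoReplicaTransienceBound.TracerDecoupling

open MeasureTheory Filter Set
open scoped ENNReal NNReal Topology BigOperators
open Literature.MathematicalPhysics.QuantumManyBody.BoseGas
open Literature.Probability.Process (brownian incRunSup preWienerMeasure)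
open MeanFreeWindow
open Summit.AtomisticToContinuum.BoseEinsteinCondensation.Cruxes.TwoReplicaTransienceBound.Insertion
open Summit.AtomisticToContinuum.BoseEinsteinCondensation.Theorems.CutLineWitness
open Summit.AtomisticToContinuum.BoseEinsteinCondensation.Cruxes.TwoReplicaTransienceBound.ShortTime

/-- **Registered stub `stub_kineticWindow`** (crux stmt-AtomisticToContinuum-9687, line `SketchIdeator1` v7; toolbox, the
SCALE-COVARIANT form of the mean-free window): for every finite-range pair potential of range `R > 0` (hard cores allowed), at
every density with packing parameter `ρR³ ≤ 10⁻⁹`, eventually in `n`, the crux integral is `≤ 20` for all polymer lengths with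
`ρ R T ≤ 10⁻⁹` — i.e. up to an absolute number of MEAN-FREE TIMES `1/(ρR)` (Smoluchowski/Spitzer scaling: slices of length `R²`,
per-slice moment `stub_sliceMomentCubic` `≤ 228128 R³`, `M ≤ 2T/R² + 1` slices, error `∝ ρ(2RT + R³)`; then c3's recursion,
survival floor and slice reduction as in `stub_meanFreeWindow`; `q₀ ≥ 4/5`). -/
theorem stub_kineticWindow :
    ∀ (v : ℝ → ENNReal) (R : ℝ), Measurable v → 0 < R → (∀ r, R < r → v r = 0) →
      ∀ ρ : ℝ, 0 < ρ → ρ * R ^ 3 ≤ 1 / 10 ^ 9 → ∀ᶠ n : ℕ in Filter.atTop, ∀ T : ℝ, 0 ≤ T → ρ * R * T ≤ 1 / 10 ^ 9 →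
        ∫⁻ Y : Config n, ENNReal.ofReal (sideLength ρ (n + 1) ^ 3) *
            (∫⁻ x, (‖@fkWitness (n + 1) v (sideLength ρ (n + 1)) T (fun _ => (1 : ENNReal))
              (Matrix.vecCons x Y)‖₊ : ENNReal) ^ 2) ^ 2 /
            (∫⁻ x, (‖@fkWitness (n + 1) v (sideLength ρ (n + 1)) T (fun _ => (1 : ENNReal))
              (Matrix.vecCons x Y)‖₊ : ENNReal)) ^ 2 ≤ ENNReal.ofReal 20 := by
  intro v R hvm hR hvR ρ hρ hρR3
  set q₀ : ℝ := 1 - 6 * Real.exp (-5) with hq₀def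
  have hq₀ : 0 < q₀ := FreeGas.q0_pos
  have hq₀' : 4 / 5 ≤ q₀ := by have h16 := sixteen_le_twenty_mul_q0; linarith
  -- slice length `R²`, per-slice constant `228128 R³`
  set τ : ℝ≥0 := ⟨R, hR.le⟩ with hτdef
  have hτR : (τ : ℝ) = R := rfl
  have hτ : 0 < τ := by rw [← NNReal.coe_pos, hτR]; exact hR
  have hh : 0 < τ ^ 2 := pow_pos hτ 2
  have hhR : ((τ ^ 2 : ℝ≥0) : ℝ) = R ^ 2 := by rw [NNReal.coe_pow, hτR]
  set Kc : ℝ≥0∞ := ENNReal.ofReal (228128 * R ^ 3) with hKcdef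
  have hK : ∀ k : ℕ, ∫⁻ ω₀, ∫⁻ ω, ENNReal.ofReal ((2 * (R + Real.sqrt 2 *
      ((∑ c, incRunSup ((k : ℝ≥0) * τ ^ 2) (τ ^ 2) (ω₀ c)) + ∑ c, incRunSup ((k : ℝ≥0) * τ ^ 2) (τ ^ 2) (ω c)))) ^ 3)
      ∂wienerLine ∂wienerLine ≤ Kc := by
    intro k
    refine (stub_sliceMomentCubic R hR.le τ hτ _).trans (le_of_eq ?_)
    rw [hKcdef, hτR]; congr 1; ring
  -- eventually in `n`: the box is large, `L ≥ L₀ = √(1920 · Tmax)`, `Tmax = 10⁻⁹/(ρR)`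
  set Tmax : ℝ := 1 / 10 ^ 9 / (ρ * R) with hTmaxdef
  have hTmax : 0 ≤ Tmax := by positivity
  set L₀ : ℝ := Real.sqrt (1920 * Tmax) with hL₀def
  have hL₀ : 0 ≤ L₀ := Real.sqrt_nonneg _
  have hev : ∀ᶠ n : ℕ in Filter.atTop, L₀ ≤ sideLength ρ (n + 1) :=
    ((tendsto_sideLength_atTop hρ).comp (tendsto_add_atTop_nat 1)).eventually_ge_atTop L₀
  filter_upwards [hev] with n hn T hT hρRT
  have hTle : T ≤ Tmax := by
    rw [hTmaxdef, le_div_iff₀ (by positivity)]; linarith [hρRT]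
  set L : ℝ := sideLength ρ (n + 1) with hLdef
  have hL : 0 < L := Real.rpow_pos_of_pos (div_pos (by exact_mod_cast Nat.succ_pos n) hρ) _
  have hL3 : L ^ 3 = ((n + 1 : ℕ) : ℝ) / ρ := sideLength_pow_three hρ (n + 1)
  -- the window condition `2T ≤ L²/960`
  have h2T : 2 * T ≤ L ^ 2 / 960 := by
    have h1 : L₀ ^ 2 ≤ L ^ 2 := pow_le_pow_left₀ hL₀ hn 2
    rw [hL₀def, Real.sq_sqrt (by positivity)] at h1
    linarith
  -- the number of slices of length `R²`
  set M : ℕ := ⌊2 * T / R ^ 2⌋₊ + 1 with hMdef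
  have hM : 1 ≤ M := Nat.le_add_left 1 _
  have hR2 : 0 < R ^ 2 := by positivity
  have h2TM : 2 * T ≤ (M : ℝ) * ((τ ^ 2 : ℝ≥0) : ℝ) := by
    rw [hhR, hMdef, Nat.cast_add_one]
    have h1 := (Nat.lt_floor_add_one (2 * T / R ^ 2)).le
    rw [div_le_iff₀ hR2] at h1
    exact h1
  have hMle : (M : ℝ) * R ^ 2 ≤ 2 * T + R ^ 2 := by
    rw [hMdef, Nat.cast_add_one]
    have h0 : (0 : ℝ) ≤ 2 * T / R ^ 2 := by positivity
    have h1 : ((⌊2 * T / R ^ 2⌋₊ : ℕ) : ℝ) ≤ 2 * T / R ^ 2 := Nat.floor_le h0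
    have h2 : ((⌊2 * T / R ^ 2⌋₊ : ℕ) : ℝ) * R ^ 2 ≤ 2 * T := by rwa [le_div_iff₀ hR2] at h1
    nlinarith
  /- ### the partition norms at this box and time -/
  set N : ℕ → ℝ≥0∞ := fun k => fkNormSq (N := k) v L T (fun _ => (1 : ℝ≥0∞)) with hNdef
  set Θ : ℝ≥0∞ := fkNormSq (N := 1) (fun _ => 0) L T (fun _ => (1 : ℝ≥0∞)) with hΘdef
  have hNtop : ∀ k, N k ≠ ⊤ := fun k =>
    Summit.AtomisticToContinuum.BoseEinsteinCondensation.Theorems.TwoReplicaTransienceBound.Negative.fkNormSq_one_ne_top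
      (N := k) v L hT
  have hΘtop : Θ ≠ ⊤ :=
    Summit.AtomisticToContinuum.BoseEinsteinCondensation.Theorems.TwoReplicaTransienceBound.Negative.fkNormSq_one_ne_top
      (N := 1) (fun _ => 0) L hT
  -- survival floor
  set θ₀ : ℝ≥0∞ := ENNReal.ofReal (q₀ * (L / 2) ^ 3) with hθ₀def
  have hθ₀Θ : θ₀ ≤ Θ := stub_survivalFloor L T hL hT h2T
  have hθ₀pos : θ₀ ≠ 0 := by
    rw [hθ₀def]; exact (ENNReal.ofReal_pos.2 (by positivity)).ne'
  have hθ₀top : θ₀ ≠ ⊤ := ENNReal.ofReal_ne_top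
  -- the error coefficient `A = n · |Λ| · (M · Kc)`
  set A : ℝ≥0∞ := (n : ℝ≥0∞) * (ENNReal.ofReal (L ^ 3) * ((M : ℝ≥0∞) * Kc)) with hAdef
  -- base of the recursion: `Θ N₀ ≤ N₁ = Θ`
  have hbase : Θ * N 0 ≤ N 1 := by
    calc Θ * N 0 ≤ Θ * 1 := mul_le_mul' le_rfl (fkNormSq_zero_particle_le v L T)
      _ = N 1 := by rw [mul_one, hNdef]; exact (fkNormSq_one_particle v L T).symm
  -- steps of the recursion (the sliced insertion step with slices of length `R²`)
  have hsteps : ∀ k, k + 2 ≤ n + 1 → Θ * N (k + 1) ≤ N (k + 2) + A * N k := by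
    intro k hk
    have hins := sliced_insertion_of_sliceBound (n := k) hvm hR.le hvR hL hT hh hM h2TM hK
    refine hins.trans (add_le_add le_rfl (mul_le_mul' ?_ le_rfl))
    have hk' : ((k : ℝ≥0∞) + 1) ≤ (n : ℝ≥0∞) := by exact_mod_cast (by omega : k + 1 ≤ n)
    calc ((k : ℝ≥0∞) + 1) * ENNReal.ofReal (L ^ 3) * ((M : ℝ≥0∞) * Kc)
        ≤ (n : ℝ≥0∞) * ENNReal.ofReal (L ^ 3) * ((M : ℝ≥0∞) * Kc) := mul_le_mul' (mul_le_mul' hk' le_rfl) le_rfl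
      _ = A := by rw [hAdef, mul_assoc]
  -- smallness `4A ≤ Θ²` from `ρR³ ≤ 10⁻⁹`, `ρRT ≤ 10⁻⁹` and `q₀ ≥ 4/5`
  have hsmall : 4 * A ≤ Θ ^ 2 := by
    have hM0 : (0 : ℝ) ≤ M := Nat.cast_nonneg M
    have hn0 : (0 : ℝ) ≤ n := Nat.cast_nonneg n
    -- `M R³ ρ ≤ ρR(2T) + ρR³ ≤ 3·10⁻⁹`
    have h1 : (M : ℝ) * R ^ 3 * ρ ≤ 3 / 10 ^ 9 := by
      calc (M : ℝ) * R ^ 3 * ρ = ((M : ℝ) * R ^ 2) * (R * ρ) := by ring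
        _ ≤ (2 * T + R ^ 2) * (R * ρ) := mul_le_mul_of_nonneg_right hMle (by positivity)
        _ = 2 * (ρ * R * T) + ρ * R ^ 3 := by ring
        _ ≤ 2 * (1 / 10 ^ 9) + 1 / 10 ^ 9 := add_le_add (mul_le_mul_of_nonneg_left hρRT zero_le_two) hρR3
        _ = 3 / 10 ^ 9 := by ring
    -- `256 · (M · 228128 R³) · ρ ≤ (4/5)² ≤ q₀²`
    have h2 : 256 * ((M : ℝ) * (228128 * R ^ 3)) * ρ ≤ q₀ ^ 2 := by
      calc 256 * ((M : ℝ) * (228128 * R ^ 3)) * ρ = 256 * 228128 * ((M : ℝ) * R ^ 3 * ρ) := by ring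
        _ ≤ 256 * 228128 * (3 / 10 ^ 9) := mul_le_mul_of_nonneg_left h1 (by norm_num)
        _ ≤ (4 / 5) ^ 2 := by norm_num
        _ ≤ q₀ ^ 2 := pow_le_pow_left₀ (by norm_num) hq₀' 2
    have h3 : 256 * (n : ℝ) * ((M : ℝ) * (228128 * R ^ 3)) * ρ ≤ q₀ ^ 2 * ((n : ℝ) + 1) := by
      calc 256 * (n : ℝ) * ((M : ℝ) * (228128 * R ^ 3)) * ρ = (n : ℝ) * (256 * ((M : ℝ) * (228128 * R ^ 3)) * ρ) := by
            ring
        _ ≤ (n : ℝ) * q₀ ^ 2 := mul_le_mul_of_nonneg_left h2 hn0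
        _ ≤ ((n : ℝ) + 1) * q₀ ^ 2 := mul_le_mul_of_nonneg_right (by linarith) (sq_nonneg q₀)
        _ = q₀ ^ 2 * ((n : ℝ) + 1) := mul_comm _ _
    have hn1 : ((n : ℝ) + 1) = ρ * L ^ 3 := by
      rw [hL3, Nat.cast_succ]; field_simp
    have hρne : ρ ≠ 0 := hρ.ne'
    have hreal : 4 * ((n : ℝ) * (L ^ 3 * ((M : ℝ) * (228128 * R ^ 3)))) ≤ (q₀ * (L / 2) ^ 3) ^ 2 := by
      calc 4 * ((n : ℝ) * (L ^ 3 * ((M : ℝ) * (228128 * R ^ 3))))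
          = (256 * (n : ℝ) * ((M : ℝ) * (228128 * R ^ 3)) * ρ) * (L ^ 3 / (64 * ρ)) := by
            field_simp; ring
        _ ≤ (q₀ ^ 2 * ((n : ℝ) + 1)) * (L ^ 3 / (64 * ρ)) := mul_le_mul_of_nonneg_right h3 (by positivity)
        _ = (q₀ * (L / 2) ^ 3) ^ 2 := by rw [hn1]; field_simp; ring
    have hA : 4 * A = ENNReal.ofReal (4 * ((n : ℝ) * (L ^ 3 * ((M : ℝ) * (228128 * R ^ 3))))) := by
      rw [hAdef, hKcdef, ENNReal.ofReal_mul (p := 4) (by norm_num), ENNReal.ofReal_mul (p := (n : ℝ)) hn0,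
        ENNReal.ofReal_mul (p := L ^ 3) (by positivity), ENNReal.ofReal_mul (p := (M : ℝ)) hM0,
        ENNReal.ofReal_natCast, ENNReal.ofReal_natCast, ENNReal.ofReal_ofNat]
    calc 4 * A = ENNReal.ofReal (4 * ((n : ℝ) * (L ^ 3 * ((M : ℝ) * (228128 * R ^ 3))))) := hA
      _ ≤ ENNReal.ofReal ((q₀ * (L / 2) ^ 3) ^ 2) := ENNReal.ofReal_le_ofReal hreal
      _ = θ₀ ^ 2 := by rw [hθ₀def, ENNReal.ofReal_pow (by positivity)]
      _ ≤ Θ ^ 2 := pow_le_pow_left' hθ₀Θ 2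
  -- the recursion
  have hrec : Θ * N n ≤ 2 * N (n + 1) := stub_recursion N Θ A (n + 1) hΘtop hNtop hbase hsteps hsmall n le_rfl
  /- ### the crux integral: normalisation bookkeeping and the slice reduction -/
  set 𝒩 : ℝ≥0∞ := fkNormSq (N := n + 1) v L T (fun _ => (1 : ℝ≥0∞)) with h𝒩
  set c : ℝ := (Real.sqrt 𝒩.toReal)⁻¹ with hc
  have hΨ : ∀ X, fkWitness (N := n + 1) v L T (fun _ => (1 : ℝ≥0∞)) X = c * (fkPartition v L T X).toReal :=
    fun X => fkWitness_one_eq v L T X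
  by_cases hc0 : c = 0
  · have h0 : ∀ X, fkWitness (N := n + 1) v L T (fun _ => (1 : ℝ≥0∞)) X = 0 := fun X => by
      rw [hΨ X, hc0, zero_mul]
    simp [h0]
  have hsqrt : Real.sqrt 𝒩.toReal ≠ 0 := fun h => hc0 (by rw [hc, h, inv_zero])
  have htR : 0 < 𝒩.toReal := not_le.1 fun h => hsqrt (Real.sqrt_eq_zero'.2 h)
  have h𝒩0 : 𝒩 ≠ 0 := fun h => htR.ne' (by rw [h, ENNReal.toReal_zero])
  have h𝒩top : 𝒩 ≠ ⊤ := fun h => htR.ne' (by rw [h, ENNReal.toReal_top])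
  have hc𝒩 : ENNReal.ofReal (c ^ 2) * 𝒩 = 1 := by
    have hc2 : c ^ 2 = (𝒩.toReal)⁻¹ := by rw [hc, inv_pow, Real.sq_sqrt htR.le]
    rw [hc2, ENNReal.ofReal_inv_of_pos htR, ENNReal.ofReal_toReal h𝒩top, ENNReal.inv_mul_cancel h𝒩0 h𝒩top]
  have hnn : ∀ X : Config (n + 1), (‖(fkPartition v L T X).toReal‖₊ : ℝ≥0∞) = fkPartition v L T X :=
    fun X => coe_nnnorm_toReal (fkPartition_ne_top v L T X)
  simp_rw [hΨ]
  rw [lintegral_ratio_const_mul L (fun X => (fkPartition v L T X).toReal) hc0]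
  simp_rw [hnn]
  set I : ℝ≥0∞ := ENNReal.ofReal (c ^ 2) * ∫⁻ Y : Config n, ENNReal.ofReal (L ^ 3) *
      (∫⁻ x, fkPartition v L T (Matrix.vecCons x Y) ^ 2) ^ 2 /
        (∫⁻ x, fkPartition v L T (Matrix.vecCons x Y)) ^ 2 with hI
  have hI1 : I ≤ ENNReal.ofReal (c ^ 2) * (ENNReal.ofReal (L ^ 3) * N n) :=
    mul_le_mul' le_rfl (lintegral_ratio_le hvm L T)
  have hI2 : Θ * I ≤ 2 * ENNReal.ofReal (L ^ 3) := by
    calc Θ * I ≤ Θ * (ENNReal.ofReal (c ^ 2) * (ENNReal.ofReal (L ^ 3) * N n)) := mul_le_mul' le_rfl hI1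
      _ = ENNReal.ofReal (c ^ 2) * ENNReal.ofReal (L ^ 3) * (Θ * N n) := by ring
      _ ≤ ENNReal.ofReal (c ^ 2) * ENNReal.ofReal (L ^ 3) * (2 * N (n + 1)) := mul_le_mul' le_rfl hrec
      _ = 2 * ENNReal.ofReal (L ^ 3) * (ENNReal.ofReal (c ^ 2) * 𝒩) := by rw [hNdef]; ring
      _ = 2 * ENNReal.ofReal (L ^ 3) := by rw [hc𝒩, mul_one]
  have hI3 : I ≤ 2 * ENNReal.ofReal (L ^ 3) / θ₀ := by
    rw [ENNReal.le_div_iff_mul_le (Or.inl hθ₀pos) (Or.inl hθ₀top)]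
    calc I * θ₀ = θ₀ * I := mul_comm _ _
      _ ≤ Θ * I := mul_le_mul' hθ₀Θ le_rfl
      _ ≤ 2 * ENNReal.ofReal (L ^ 3) := hI2
  refine hI3.trans ?_
  have hL3pos : 0 < L ^ 3 := by positivity
  rw [hθ₀def, ← ENNReal.ofReal_ofNat 2, ← ENNReal.ofReal_mul (by norm_num),
    ← ENNReal.ofReal_div_of_pos (by positivity)]
  refine ENNReal.ofReal_le_ofReal ?_
  rw [div_le_iff₀ (by positivity)]
  have h16 := sixteen_le_twenty_mul_q0
  nlinarith [hL3pos, h16, hq₀]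

end Summit.AtomisticToContinuum.BoseEinsteinCondensation.Cruxes.TwoReplicaTransienceBound.TracerDecoupling

end
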